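import Summits.KontsevichZagierPeriods.Zeta5Search.LaiSweepShard

/-!
# `κ₃` sweep certificate — shard file 002 of 127 (shards 14–20 of 889)

HONEST FRAMING. Systematic search; no irrationality claim unless certified. This file only checks,
by `decide +kernel`, shards 14–20 of the order-cell sweep of the `κ₃` point `(74, 2180, 444; δ74)`
(engine `LaiSweepEngine`, soundness `LaiSweepJump/Free/Eval/Shard/Kappa3`; a shard is `⟨regime, n,
p, q, p', q', Lo, Up⟩`: `n` cells from `p/q` to `p'/q'` with integer rate sums in `[Lo, Up]`, `K =
128`, `D = 2^40`). It draws NO conclusion: only the capstone `LaiKappa3SweepCert`, which needs all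
127 shard files, does. Kernel cost of this file ≈ 560 cells × 0.3 s.
-/

namespace Summit.KontsevichZagierPeriods.Zeta5Search.Sweep

set_option maxHeartbeats 100000000 in
/-- Shard 14: 80 cells of regime A from `4/731` to `3/521`.
[cite: Lai2024BallRivoal, §4 Lemma 4.3] -/
theorem shard014 :
    Shard.check 128 (2^40)
      ⟨false, 80, 4, 731, 3, 521, 580205297455681, 580901599897299⟩ = true := by
  decide +kernel

set_option maxHeartbeats 100000000 in
/-- Shard 15: 80 cells of regime A from `3/521` to `13/2195`.
[cite: Lai2024BallRivoal, §4 Lemma 4.3] -/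
theorem shard015 :
    Shard.check 128 (2^40)
      ⟨false, 80, 3, 521, 13, 2195, 293311968154375, 293456993617315⟩ = true := by
  decide +kernel

set_option maxHeartbeats 100000000 in
/-- Shard 16: 80 cells of regime A from `13/2195` to `1/161`.
[cite: Lai2024BallRivoal, §4 Lemma 4.3] -/
theorem shard016 :
    Shard.check 128 (2^40)
      ⟨false, 80, 13, 2195, 1, 161, 461314935584526, 461955123656672⟩ = true := by
  decide +kernel

set_option maxHeartbeats 100000000 in
/-- Shard 17: 80 cells of regime A from `1/161` to `2/309`.
[cite: Lai2024BallRivoal, §4 Lemma 4.3] -/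
theorem shard017 :
    Shard.check 128 (2^40)
      ⟨false, 80, 1, 161, 2, 309, 365522437608320, 365889197848853⟩ = true := by
  decide +kernel

set_option maxHeartbeats 100000000 in
/-- Shard 18: 80 cells of regime A from `2/309` to `15/2242`.
[cite: Lai2024BallRivoal, §4 Lemma 4.3] -/
theorem shard018 :
    Shard.check 128 (2^40)
      ⟨false, 80, 2, 309, 15, 2242, 271882496830779, 272047699071304⟩ = true := by
  decide +kernel

set_option maxHeartbeats 100000000 in
/-- Shard 19: 80 cells of regime A from `15/2242` to `9/1300`.
[cite: Lai2024BallRivoal, §4 Lemma 4.3] -/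
theorem shard019 :
    Shard.check 128 (2^40)
      ⟨false, 80, 15, 2242, 9, 1300, 268276545363528, 268420316285630⟩ = true := by
  decide +kernel

set_option maxHeartbeats 100000000 in
/-- Shard 20: 80 cells of regime A from `9/1300` to `8/1111`.
[cite: Lai2024BallRivoal, §4 Lemma 4.3] -/
theorem shard020 :
    Shard.check 128 (2^40)
      ⟨false, 80, 9, 1300, 8, 1111, 374661029777307, 374902040367356⟩ = true := by
  decide +kernel

/-- The checked shards of this file, in order. [folklore] -/
def shards002 : List (CheckedShard 128 (2^40)) :=
  [⟨_, shard014⟩, ⟨_, shard015⟩, ⟨_, shard016⟩, ⟨_, shard017⟩, ⟨_, shard018⟩,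
    ⟨_, shard019⟩, ⟨_, shard020⟩]

end Summit.KontsevichZagierPeriods.Zeta5Search.Sweep
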